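import Mathlib
import Summits.Ventures.HodgeRepro.Tier4.Common.AdelicRTF
import Summits.Ventures.HodgeRepro.Tier4.Common.MixedPlane
import Summits.Ventures.HodgeRepro.Tier4.Line4.TwoTorusCut

/-!
# Tier4/Line4/RieszOnKType — the Riesz vector of the `T′`-period on a FINITE-dimensional `K`-type space, for the `L²`
pairing over a fundamental domain of `G(k)`: the honest (C4) clause of the L4 wall (re-typing of TwoTorusCut's
`IsRieszVector`, whose `∀ t ∈ T′(𝔸)`-equivariance is an over-typing — bus S13203), W2′ and the glue

Blind re-derivation cell `pub-hodge-repro`, Tier 4 «prove the step» (README §9–§10), seat t4-L4-p1 (gen 2).  Tree path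
`lean/Summits/Ventures/HodgeRepro/Tier4/Line4/RieszOnKType.lean`.  Imports `Common/AdelicRTF` (`RTFData`,
`periodLin`), `Common/MixedPlane` (`restrictTo`, `HasNonzeroToricPeriod`) and `Line4/TwoTorusCut` (`IsAdmissible`).
PREPARED for plan-4's re-typing of the wall (RIGIDITY RULE: a new skeleton version with a critic read); a HOME
artefact until then.

THE POINT (S13203 (B)–(C)).  A smooth irreducible `V` has no `T′(𝔸)`-eigenvector once `T′` splits at a finite
place (Kirillov model), so «`f ∈ V` with `f(x t) = χ̄′(t) f(x)` for all `t ∈ T′(𝔸)`» cannot be met by smooth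
vectors.  The seesaw contribution of `V` (L4-MATH §11) is `∑_{φ ∈ ONB(V^τ)} conj(P_{χ′}(φ)) P_χ(φ)` over the
FINITE-dimensional `K`-type space `V^τ`, i.e. `P_χ(f)` for `f` the Riesz vector of the functional `P_{χ′}|_{V^τ}`
with respect to the `L²` pairing `⟪φ, ψ⟫ := ∫_{D_G} φ · conj ψ` over a fundamental domain `D_G` of `G(k)` in `G(𝔸)`
(Haar data on `G(𝔸)` as parameters, L1's `Setting` shape).  DEFINED: `innerDG μ DG φ ψ`; `IsRieszVectorOn R μ DG Vτ f`
(`f ∈ Vτ`, `f ≠ 0`, `⟪φ, f⟫ = P_{χ′}(φ|_{T′})` for all `φ ∈ Vτ`); `HasNonzeroMixedPeriodOn R μ DG Vτ` (some Riesz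
vector of `Vτ` has non-zero `T`-period against `χ`).  PROVED: W2′ `period_eq_innerDG_self`
(`P_{χ′}(f|_{T′}) = ⟪f, f⟫`), `innerDG_self_eq` (`⟪f, f⟫ = ∫_{D_G} ‖f‖²`, a non-negative real), hence
`hasNonzeroToricPeriod_of_rieszOn` from `∫_{D_G} ‖f‖² ≠ 0` (DISPLAYED — it follows from `f ≠ 0`, continuity and
the Haar data, the L1-style positivity lemma, not re-proved here), and the GLUE `exists_spectrum_of_rungs'`: from
an admissible `V` with a finite-dimensional `Vτ ≤ V` carrying a Riesz vector of non-zero `T`-period and non-zero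
norm, the wall's conclusion WITHOUT the over-typed equivariance clause — the six spectral clauses, `P_{χ′} ≠ 0` on
`V`, and `∃ f ∈ V, f ≠ 0 ∧ P_χ(f|_T) ≠ 0`.  The content W3′ (`HasNonzeroMixedPeriodOn`) stays the displayed
simultaneous non-vanishing.

`Vτ` IS A PARAMETER THE WALL MUST PIN (t4-plan-4 S13216 (2), t4-crit-2 S13222): with `Vτ` existentially free the
hypothesis of the glue collapses to «`∃ f ∈ V`, `P_{χ′}(f) ≠ 0` and `P_χ(f) ≠ 0`» (`Vτ := span{f}` and the rescaling
`f ↦ (conj P_{χ′}(f) / ⟪f, f⟫) · f`), which is strictly weaker than the seesaw's requirement on the Riesz vector of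
`P_{χ′}` over the WHOLE `K`-type space `V^τ` (whose seesaw term `∑_{φ ∈ ONB(V^τ)} conj(P_{χ′}(φ)) P_χ(φ)` can cancel)
— an under-typing of the bridge [I2].  The re-cut wall therefore instantiates `Vτ := fixedBy W K (weight space)` =
the full `K`-type space (typer-2's `Common/LocalTorus` v0.2: `finitePart`, `IsCompactOpenIn`, `fixedBy`), never a
free `Vτ`; nothing in this module asserts the wall.

HC_CM is NOT proved by anyone in this repository.
-/

set_option autoImplicit false

noncomputable section

namespace Summit.Ventures.HodgeRepro.Tier4.Line4

open Summit.Ventures.HodgeRepro.Tier4.Common MeasureTheory NumberField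
open scoped ComplexConjugate

section Inner

variable {k : Type} [Field k] [NumberField k] {W : PlaneData k} [MeasurableSpace (GA W)]
  (μ : Measure (GA W)) (DG : Set (GA W))

/-- **The `L²` pairing over a fundamental domain `D_G` of `G(k)`**: `⟪φ, ψ⟫ := ∫_{D_G} φ · conj ψ dμ`. -/
def innerDG (φ ψ : GA W → ℂ) : ℂ := ∫ x in DG, φ x * conj (ψ x) ∂μ

/-- `⟪f, f⟫ = ∫_{D_G} ‖f‖²`, a non-negative real number. -/
theorem innerDG_self_eq (f : GA W → ℂ) :
    innerDG μ DG f f = ((∫ x in DG, ‖f x‖ ^ 2 ∂μ : ℝ) : ℂ) := by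
  unfold innerDG
  rw [← integral_complex_ofReal]
  congr 1
  funext x
  rw [Complex.mul_conj, Complex.normSq_eq_norm_sq]

/-- `⟪f, f⟫ ≠ 0` as soon as `∫_{D_G} ‖f‖² ≠ 0`. -/
theorem innerDG_self_ne_zero (f : GA W → ℂ) (h : (∫ x in DG, ‖f x‖ ^ 2 ∂μ : ℝ) ≠ 0) : innerDG μ DG f f ≠ 0 := by
  rw [innerDG_self_eq]
  exact_mod_cast h

end Inner

section Riesz

variable {k : Type} [Field k] [NumberField k] {W : PlaneData k}
  [MeasurableSpace (torusT W)] [MeasurableSpace (torusT' W)] (R : RTFData W)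
  [MeasurableSpace (GA W)] (μ : Measure (GA W)) (DG : Set (GA W))

/-- **The Riesz vector of `P_{χ′}` on a `K`-type space `Vτ`** for the pairing `⟪·,·⟫` over `D_G`: `f ∈ Vτ`, `f ≠ 0`,
and `⟪φ, f⟫ = P_{χ′}(φ|_{T′})` for every `φ ∈ Vτ` (no equivariance under `T′(𝔸)` is asked — none holds). -/
def IsRieszVectorOn (Vτ : Submodule ℂ (GA W → ℂ)) (f : GA W → ℂ) : Prop :=
  f ∈ Vτ ∧ f ≠ 0 ∧ ∀ φ ∈ Vτ, innerDG μ DG φ f = periodLin W R.μT' R.DT' R.chi' (restrictTo W (torusT' W) φ)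

/-- **The mixed-period clause on the `K`-type space**: some Riesz vector of `Vτ` has a non-zero `T`-period against `χ`. -/
def HasNonzeroMixedPeriodOn (Vτ : Submodule ℂ (GA W → ℂ)) : Prop :=
  ∃ f, IsRieszVectorOn R μ DG Vτ f ∧ periodLin W R.μT R.DT R.chi (restrictTo W (torusT W) f) ≠ 0

/-- **W2′, the identity**: the `T′`-period of the Riesz vector is its own squared norm, `P_{χ′}(f|_{T′}) = ⟪f, f⟫`. -/
theorem period_eq_innerDG_self {Vτ : Submodule ℂ (GA W → ℂ)} {f : GA W → ℂ} (hf : IsRieszVectorOn R μ DG Vτ f) :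
    periodLin W R.μT' R.DT' R.chi' (restrictTo W (torusT' W) f) = innerDG μ DG f f :=
  (hf.2.2 f hf.1).symm

/-- **W2′**: a Riesz vector of non-zero norm witnesses `P_{χ′} ≠ 0` on every `V ≥ Vτ`. -/
theorem hasNonzeroToricPeriod_of_rieszOn {Vτ V : Submodule ℂ (GA W → ℂ)} (hle : Vτ ≤ V) {f : GA W → ℂ}
    (hf : IsRieszVectorOn R μ DG Vτ f) (hne : (∫ x in DG, ‖f x‖ ^ 2 ∂μ : ℝ) ≠ 0) :
    HasNonzeroToricPeriod W R.μT' R.DT' R.chi' V := by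
  refine ⟨f, hle hf.1, ?_⟩
  rw [period_eq_innerDG_self R μ DG hf]
  exact innerDG_self_ne_zero μ DG f hne

/-- **THE GLUE of the re-cut** `W3′ → the wall's conclusion without the over-typed equivariance clause`: from an
admissible `V`, a `K`-type space `Vτ ≤ V` (finite-dimensional) with a Riesz vector of non-zero `T`-period whose norm
is non-zero, the six spectral clauses, `P_{χ′} ≠ 0` on `V`, and `∃ f ∈ V, f ≠ 0 ∧ P_χ(f|_T) ≠ 0`. -/
theorem exists_spectrum_of_rungs' (q : QuadData k) (g g' : Matrix (Fin 4) (Fin 4) k) (w₀ : InfinitePlace k)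
    (eP eM eP' eM' : InfinitePlace k → ℤ)
    (h3 : ∃ V Vτ : Submodule ℂ (GA W → ℂ), IsAdmissible W q g g' w₀ eP eM eP' eM' V ∧ Vτ ≤ V ∧
      FiniteDimensional ℂ Vτ ∧
      ∃ f, IsRieszVectorOn R μ DG Vτ f ∧ (∫ x in DG, ‖f x‖ ^ 2 ∂μ : ℝ) ≠ 0 ∧
        periodLin W R.μT R.DT R.chi (restrictTo W (torusT W) f) ≠ 0) :
    ∃ V : Submodule ℂ (GA W → ℂ),
      IsIrreducibleAutomorphic W V ∧
      IsCuspidalSubspace W V ∧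
      (∀ w, HasKTypeAt W q w (eP w) (eM w) V) ∧
      (∀ j : ℤ, |(eP w₀ - eM w₀) + 2 * j| < 3 → ¬ HasKTypeAt W q w₀ (eP w₀ + j) (eM w₀ - j) V) ∧
      (∀ w, HasKTypeAt' W q w g g' (eP' w) (eM' w) V) ∧
      (∀ j : ℤ, |(eP' w₀ - eM' w₀) + 2 * j| < 3 → ¬ HasKTypeAt' W q w₀ g g' (eP' w₀ + j) (eM' w₀ - j) V) ∧
      HasNonzeroToricPeriod W R.μT' R.DT' R.chi' V ∧
      ∃ f ∈ V, f ≠ 0 ∧ periodLin W R.μT R.DT R.chi (restrictTo W (torusT W) f) ≠ 0 := by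
  obtain ⟨V, Vτ, ⟨hirr, hcusp, hK, hlow, hK', hlow'⟩, hle, _, f, hf, hne, hmixed⟩ := h3
  exact ⟨V, hirr, hcusp, hK, hlow, hK', hlow', hasNonzeroToricPeriod_of_rieszOn R μ DG hle hf hne,
    f, hle hf.1, hf.2.1, hmixed⟩

end Riesz

end Summit.Ventures.HodgeRepro.Tier4.Line4

end
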